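import Summits.CriticalPhenomena.PercolationContinuityZ3.Theorems.Transplant.HexShadowVRouteData
import Summits.CriticalPhenomena.PercolationContinuityZ3.Theorems.Transplant.HexShadowBlocks
import HarnessLib

/-!
# HEXAGONAL SHADOWS LI — the cleared blocks of the local surgery at a general SURGERY RADIUS `R`: `DblkR`, `RPblkR`, the exceptional sets, the inclusions

builds on p205010 (kernel theorem, internal audit signed; external expert review pending) — NOT used in this file.  Lane `prim-bschramm`, seat
`prim-bschramm-p2` (gen 39; class C1b; memo `HOME/bschramm/P2-LATTICES.md` §136 (11),(13), §137); helper file (`--supports stmt-CriticalPhenomena-4575 --as helper`).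

WHY.  «HexShadowBlocks» fixes DST's surgery radius `R = 3` (`Dblk`, `RPblk`, `zTouch`, `tR`, `X₁`, `X₂`, `zBad` are all built on `hexBall z 3`), and so does the
routing «HexShadowVRouting» (`ShapedLinkage 3`).  The `(111)`-film of thickness `3` has NO admissible cleared set at radius `3` (gen 38, exhaustive search) but its
radius-`4` node `ShapedLinkage 4` is kernel-certified («Slab111SK4FinalK3», p699989).  This file is «HexShadowBlocks» VERBATIM with the radius a parameter `R`
(the clip parameters `tD`, `sD`, `sR` are radius-free and reused):
* §1 `mem_blkR_iff_lin`, `blkR_mono`, `blkR_subset_hexBall`; `zTouchR`, `tRR`, **`DblkR R Γ z = blkR R z t_D s_D`**, **`RPblkR R Γ z = blkR R z t_R s_R`**, the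
  exceptional sets `X₁R`, `X₂R`, `zBadR` (for `R = 3` these are the objects of «HexShadowBlocks», by `rfl`);
* §2 the inclusions the surgery needs, now for `2R + 1 ≤ m`: `RPblkR ⊆ DblkR ⊆ hexBall z R`, `DblkR ⊆ big ∪ small` off `X₁R`, `RPblkR ⊆ big`, `RPblkR ∩ Z_n = ∅` off
  `zBadR`, `hexBall z R ∩ big ⊆ DblkR`, `hexBall z R ∩ small ⊆ DblkR`, `DblkR ∩ S_{3n} = ∅`, "clipped in at most one direction" off `X₂R`, `mem_RPblkR_of`;
* §3 `X₁R`, `X₂R`, `zBadR` lie in lattice hexagons of radii `R`, `R + 1`, `4R`.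
[cite: DuminilCopinSidoraviciusTassion2016, §2.3 (proof of Fact 2: the balls B_R(z), B_{R+1}(z) inside B_{3n} ∪ B'_n; "fix R large enough")]
-/

noncomputable section

namespace Summit.CriticalPhenomena.PercolationContinuityZ3.Theorems.Transplant

open MeasureTheory Literature.Probability.Percolation Literature.Probability.LatticeModels SimpleGraph Filter
open scoped Classical Topology

/-! ## §1 Linear membership; the blocks at radius `R` -/

/-- Membership in a clipped block of radius `R`, in linear form. [folklore] -/
theorem mem_blkR_iff_lin {R : ℕ} {z : Site 2} {t s : ℕ} {w : Site 2} :
    w ∈ blkR R z t s ↔ ((-(R : ℤ) ≤ w 0 - z 0 ∧ w 0 - z 0 ≤ R) ∧ (-(R : ℤ) ≤ w 1 - z 1 ∧ w 1 - z 1 ≤ R) ∧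
      (-(R : ℤ) ≤ w 0 - z 0 + (w 1 - z 1) ∧ w 0 - z 0 + (w 1 - z 1) ≤ R)) ∧ w 0 ≤ z 0 + t ∧ w 0 + w 1 ≤ z 0 + z 1 + s := by
  rw [mem_blkR, mem_hexBall_iff_lin]

/-- Clipped blocks are monotone in the clip parameters. [folklore] -/
theorem blkR_mono (R : ℕ) (z : Site 2) {t t' s s' : ℕ} (ht : t ≤ t') (hs : s ≤ s') : blkR R z t s ⊆ blkR R z t' s' := by
  intro w hw
  rw [mem_blkR] at hw ⊢
  exact ⟨hw.1, by omega, by omega⟩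

/-- A clipped block of radius `R` lies in the hexagon of radius `R`. [folklore] -/
theorem blkR_subset_hexBall (R : ℕ) (z : Site 2) (t s : ℕ) : blkR R z t s ⊆ hexBall z R := fun _ hw => hw.1

namespace HexShadow

variable {V : Type} {G : SimpleGraph V} (Φ : HexShadow G)

/-- `Z_n` meets the hexagon `hexBall z R`. [folklore] -/
def zTouchR (R : ℕ) (Γ : GlueData) (z : Site 2) : Prop := ∃ w ∈ hexBall z R, w ∈ Φ.zSeg Γ

/-- The `ξ`-clip parameter of the rerouting block of radius `R`: one less than that of the cleared block when `Z_n` meets the hexagon `hexBall z R` (the column line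
of `Z_n` is then dropped), else the same. [cite: DuminilCopinSidoraviciusTassion2016, §2.3, proof of Fact 2] -/
def tRR (R : ℕ) (Γ : GlueData) (z : Site 2) : ℕ := if Φ.zTouchR R Γ z then Φ.tD Γ z - 1 else Φ.tD Γ z

/-- **The cleared block `D(z)` of radius `R`** (the formalisation's `\overline{B_R(z)}`, clipped to the window).
[cite: DuminilCopinSidoraviciusTassion2016, §2.3, proof of Fact 2 (the ball B_R(z))] -/
def DblkR (R : ℕ) (Γ : GlueData) (z : Site 2) : Set (Site 2) := blkR R z (Φ.tD Γ z) (Φ.sD Γ z)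

/-- **The rerouting block `RP(z)` of radius `R`**: the part of `D(z)` in `B_{3n}`, minus the column line of `Z_n` when `Z_n` meets the hexagon.
[cite: DuminilCopinSidoraviciusTassion2016, §2.3, proof of Fact 2] -/
def RPblkR (R : ℕ) (Γ : GlueData) (z : Site 2) : Set (Site 2) := blkR R z (Φ.tRR R Γ z) (Φ.sR Γ z)

/-- The exceptional points near the top corner of `small` (where `D(z)` could leave the window), radius `R`. [folklore] -/
def X₁R (R : ℕ) (Γ : GlueData) : Set (Site 2) :=
  {z | Φ.centre 0 + Φ.centre 1 + 6 * Γ.m - R ≤ z 0 + z 1 ∧ Φ.centre 1 + Φ.period * Γ.s + 2 * Γ.m - R ≤ z 1}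

/-- The exceptional points near the corner `c + (6m, 0)` of `B_{3n}` (where both clips are active), radius `R`. [folklore] -/
def X₂R (R : ℕ) (Γ : GlueData) : Set (Site 2) :=
  {z | Φ.centre 0 + 6 * Γ.m - (R + 1) ≤ z 0 ∧ Φ.centre 0 + Φ.centre 1 + 6 * Γ.m - (R + 1) ≤ z 0 + z 1}

/-- The exceptional points whose hexagon of radius `R` is cut PARTIALLY by `Z_n` (near the two ends of `Z_n`). [folklore] -/
def zBadR (R : ℕ) (Γ : GlueData) : Set (Site 2) := {z | Φ.zTouchR R Γ z ∧ ∃ w ∈ hexBall z R, w 0 = Φ.centre 0 + 6 * Γ.m ∧ w ∉ Φ.zSeg Γ}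

/-- At radius `3` these are the objects of «HexShadowBlocks». [folklore] -/
theorem zTouchR_three : Φ.zTouchR 3 = Φ.zTouch := rfl

/-- At radius `3` these are the objects of «HexShadowBlocks». [folklore] -/
theorem tRR_three : Φ.tRR 3 = Φ.tR := rfl

/-- At radius `3` these are the objects of «HexShadowBlocks». [folklore] -/
theorem DblkR_three : Φ.DblkR 3 = Φ.Dblk := rfl

/-- At radius `3` these are the objects of «HexShadowBlocks». [folklore] -/
theorem RPblkR_three : Φ.RPblkR 3 = Φ.RPblk := rfl

/-- At radius `3` these are the objects of «HexShadowBlocks». [folklore] -/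
theorem zBadR_three : Φ.zBadR 3 = Φ.zBad := rfl

/-! ## §2 The inclusions -/

variable {Φ}

/-- `RP(z) ⊆ D(z)`. [folklore] -/
theorem RPblkR_subset_DblkR (R : ℕ) (Γ : GlueData) (z : Site 2) : Φ.RPblkR R Γ z ⊆ Φ.DblkR R Γ z := by
  refine blkR_mono R z ?_ ?_
  · unfold tRR; split_ifs <;> omega
  · unfold sR sD
    have : (0 : ℤ) ≤ max (Φ.period * Γ.s) 0 := le_max_right _ _
    omega

/-- The clip parameters of `RP(z)` are at most those of `D(z)`. [folklore] -/
theorem tRR_le_tD (R : ℕ) (Γ : GlueData) (z : Site 2) : Φ.tRR R Γ z ≤ Φ.tD Γ z ∧ Φ.sR Γ z ≤ Φ.sD Γ z := by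
  refine ⟨?_, (tR_le_tD (Φ := Φ) Γ z).2⟩
  unfold tRR; split_ifs <;> omega

/-- `D(z) ⊆ hexBall z R`. [folklore] -/
theorem DblkR_subset_hexBall (R : ℕ) (Γ : GlueData) (z : Site 2) : Φ.DblkR R Γ z ⊆ hexBall z R := blkR_subset_hexBall _ _ _ _

/-- **`hexBall z R ∩ B_{3n} ⊆ D(z)`.** [folklore] -/
theorem hexBall_inter_big_subset_DblkR {R : ℕ} (Γ : GlueData) (z : Site 2) {w : Site 2} (hw : w ∈ hexBall z R) (hwb : w ∈ Φ.big Γ) :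
    w ∈ Φ.DblkR R Γ z := by
  rw [mem_big_iff] at hwb
  refine ⟨hw, ?_, ?_⟩
  · unfold tD; omega
  · unfold sD
    have : (0 : ℤ) ≤ max (Φ.period * Γ.s) 0 := le_max_right _ _
    omega

/-- **`hexBall z R ∩ B'_n ⊆ D(z)`.** [folklore] -/
theorem hexBall_inter_small_subset_DblkR {R : ℕ} (Γ : GlueData) (z : Site 2) {w : Site 2} (hw : w ∈ hexBall z R) (hws : w ∈ Φ.small Γ) :
    w ∈ Φ.DblkR R Γ z := by
  rw [mem_small_iff] at hws
  refine ⟨hw, ?_, ?_⟩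
  · unfold tD; omega
  · unfold sD
    have : Φ.period * Γ.s ≤ max (Φ.period * Γ.s) 0 := le_max_left _ _
    omega

/-- **`RP(z) ⊆ B_{3n}`** for `z ∈ big ∩ small`, `2R + 1 ≤ m`. [folklore] -/
theorem RPblkR_subset_big {R : ℕ} {Γ : GlueData} (hΓ : Φ.InRange Γ) (hm : 2 * R + 1 ≤ Γ.m) {z : Site 2} (hzb : z ∈ Φ.big Γ) (hzs : z ∈ Φ.small Γ) :
    Φ.RPblkR R Γ z ⊆ Φ.big Γ := by
  intro w hw
  obtain ⟨-, -, -, -, -, hs1, hs2⟩ := hΓ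
  rw [RPblkR, mem_blkR_iff_lin] at hw
  rw [mem_big_iff] at hzb ⊢
  rw [mem_small_iff] at hzs
  have htR : (Φ.tRR R Γ z : ℤ) ≤ Φ.centre 0 + 6 * Γ.m - z 0 := by
    have h1 : Φ.tRR R Γ z ≤ Φ.tD Γ z := (tRR_le_tD R Γ z).1
    have h2 : ((Φ.tD Γ z : ℕ) : ℤ) = Φ.centre 0 + 6 * Γ.m - z 0 := by unfold tD; omega
    omega
  have hsR : ((Φ.sR Γ z : ℕ) : ℤ) = Φ.centre 0 + Φ.centre 1 + 6 * Γ.m - (z 0 + z 1) := by unfold sR; omega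
  omega

/-- **`D(z) ⊆ B_{3n} ∪ B'_n`** for `z ∈ big ∩ small` off `X₁R`, `2R + 1 ≤ m`. [cite: DuminilCopinSidoraviciusTassion2016, §2.3, proof of Fact 2 (B_{R+1}(z) inside B_{3n} ∪ B'_n)] -/
theorem DblkR_subset_window {R : ℕ} {Γ : GlueData} (hΓ : Φ.InRange Γ) (hm : 2 * R + 1 ≤ Γ.m) {z : Site 2} (hzb : z ∈ Φ.big Γ) (hzs : z ∈ Φ.small Γ)
    (hX : z ∉ Φ.X₁R R Γ) : Φ.DblkR R Γ z ⊆ Φ.big Γ ∪ Φ.small Γ := by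
  intro w hw
  obtain ⟨-, -, -, -, -, hs1, hs2⟩ := hΓ
  rw [DblkR, mem_blkR_iff_lin] at hw
  simp only [X₁R, Set.mem_setOf_eq, not_and_or, not_le] at hX
  rw [Set.mem_union, mem_big_iff, mem_small_iff]
  rw [mem_big_iff] at hzb
  rw [mem_small_iff] at hzs
  have htD : ((Φ.tD Γ z : ℕ) : ℤ) = Φ.centre 0 + 6 * Γ.m - z 0 := by unfold tD; omega
  have hsD : ((Φ.sD Γ z : ℕ) : ℤ) = Φ.centre 0 + Φ.centre 1 + 6 * Γ.m + max (Φ.period * Γ.s) 0 - (z 0 + z 1) := by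
    unfold sD
    have : (0 : ℤ) ≤ max (Φ.period * Γ.s) 0 := le_max_right _ _
    omega
  by_cases hσ : w 0 - Φ.centre 0 + (w 1 - Φ.centre 1) ≤ 6 * Γ.m
  · left; omega
  · right
    have hmax : max (Φ.period * Γ.s) 0 = Φ.period * Γ.s := by
      rcases le_or_gt (Φ.period * Γ.s) 0 with h | h
      · exfalso; rw [max_eq_right h] at hsD; omega
      · exact max_eq_left h.le
    rw [hmax] at hsD
    omega

/-- **`RP(z)` misses `Z_n`** for `z ∈ B_{3n} ∖ Z_n` off `zBadR`. [folklore] -/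
theorem RPblkR_disjoint_zSeg {R : ℕ} {Γ : GlueData} {z : Site 2} (hzbig : z ∈ Φ.big Γ) (hzZ : z ∉ Φ.zSeg Γ) (hzb : z ∉ Φ.zBadR R Γ) {w : Site 2}
    (hw : w ∈ Φ.RPblkR R Γ z) : w ∉ Φ.zSeg Γ := by
  intro hwZ
  have htouch : Φ.zTouchR R Γ z := ⟨w, blkR_subset_hexBall _ _ _ _ hw, hwZ⟩
  have hall : ∀ w' ∈ hexBall z R, w' 0 = Φ.centre 0 + 6 * Γ.m → w' ∈ Φ.zSeg Γ := by
    intro w' hw' h0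
    by_contra hnot
    exact hzb ⟨htouch, w', hw', h0, hnot⟩
  have htR : Φ.tRR R Γ z = Φ.tD Γ z - 1 := by simp [tRR, htouch]
  rw [RPblkR, mem_blkR_iff_lin, htR] at hw
  rw [mem_zSeg_iff] at hwZ
  rw [mem_big_iff] at hzbig
  rcases Nat.eq_zero_or_pos (Φ.tD Γ z) with h0 | hpos
  · -- `z` lies on the column line of `Z_n`, hence in `Z_n`
    have hz0 : z 0 = Φ.centre 0 + 6 * Γ.m := by unfold tD at h0; omega
    exact hzZ (hall z (by rw [mem_hexBall_iff_lin]; omega) hz0)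
  · have : ((Φ.tD Γ z - 1 : ℕ) : ℤ) = Φ.centre 0 + 6 * Γ.m - z 0 - 1 := by unfold tD at hpos ⊢; omega
    omega

/-- **`D(z)` misses `S_{3n}`** for `z ∈ B'_n`, `2R + 1 ≤ m` (`dist(B'_n, S_{3n}) ≥ m/2 > R`). [folklore] -/
theorem DblkR_disjoint_src {R : ℕ} {Γ : GlueData} (hΓ : Φ.InRange Γ) (hm : 2 * R + 1 ≤ Γ.m) {z : Site 2} (hzs : z ∈ Φ.small Γ) {w : Site 2}
    (hw : w ∈ Φ.DblkR R Γ z) : w ∉ Φ.src Γ := by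
  intro hws
  obtain ⟨-, hu₃, -, -, -, hs1, hs2⟩ := hΓ
  rw [DblkR, mem_blkR_iff_lin] at hw
  rw [mem_small_iff] at hzs
  rw [mem_src_iff] at hws
  omega

/-- **Off `X₂R`, the blocks are clipped in at most one direction.** [folklore] -/
theorem le_tRR_or_sR {R : ℕ} {Γ : GlueData} {z : Site 2} (hX : z ∉ Φ.X₂R R Γ) : R ≤ Φ.tRR R Γ z ∨ R ≤ Φ.sR Γ z := by
  simp only [X₂R, Set.mem_setOf_eq, not_and_or, not_le] at hX
  rcases hX with h | h
  · left
    have : R + 1 ≤ Φ.tD Γ z := by unfold tD; omega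
    unfold tRR; split_ifs <;> omega
  · right; unfold sR; omega

/-- **A point of `D(z) ∩ B_{3n}` off `Z_n` lies in `RP(z)`** (for `z ∈ B_{3n} ∖ Z_n` off `zBadR`). [folklore] -/
theorem mem_RPblkR_of {R : ℕ} {Γ : GlueData} {z : Site 2} (hzbig : z ∈ Φ.big Γ) (hzZ : z ∉ Φ.zSeg Γ) (hzb : z ∉ Φ.zBadR R Γ) {w : Site 2}
    (hwD : w ∈ Φ.DblkR R Γ z) (hwbig : w ∈ Φ.big Γ) (hwZ : w ∉ Φ.zSeg Γ) : w ∈ Φ.RPblkR R Γ z := by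
  have hwR : w ∈ hexBall z R := Φ.DblkR_subset_hexBall R Γ z hwD
  rw [DblkR, mem_blkR_iff_lin] at hwD
  rw [RPblkR, mem_blkR_iff_lin]
  rw [mem_big_iff] at hwbig hzbig
  refine ⟨hwD.1, ?_, by unfold sR; omega⟩
  have htD : ((Φ.tD Γ z : ℕ) : ℤ) = Φ.centre 0 + 6 * Γ.m - z 0 := by unfold tD; omega
  by_cases ht : Φ.zTouchR R Γ z
  · have htR : Φ.tRR R Γ z = Φ.tD Γ z - 1 := by simp [tRR, ht]
    rw [htR]
    -- `w` is not on the column line of `Z_n` (all its hexagon points are in `Z_n`), and `z` is not on it either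
    have hall : ∀ w' ∈ hexBall z R, w' 0 = Φ.centre 0 + 6 * Γ.m → w' ∈ Φ.zSeg Γ := by
      intro w' hw' h0; by_contra hnot; exact hzb ⟨ht, w', hw', h0, hnot⟩
    have hw0 : w 0 ≠ Φ.centre 0 + 6 * Γ.m := fun h0 => hwZ (hall w hwR h0)
    have hz0 : z 0 ≠ Φ.centre 0 + 6 * Γ.m := fun h0 => hzZ (hall z (by rw [mem_hexBall_iff_lin]; omega) h0)
    have hpos : 1 ≤ Φ.tD Γ z := by omega
    have : ((Φ.tD Γ z - 1 : ℕ) : ℤ) = Φ.centre 0 + 6 * Γ.m - z 0 - 1 := by omega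
    omega
  · have htR : Φ.tRR R Γ z = Φ.tD Γ z := by simp [tRR, ht]
    rw [htR]; omega

/-! ## §3 The exceptional sets are bounded -/

/-- `X₁R ∩ big ∩ small` lies in the hexagon of radius `R` about the top corner `c + (4m − P·s, P·s + 2m)` of `small`. [folklore] -/
theorem X₁R_subset {R : ℕ} {Γ : GlueData} {z : Site 2} (hz : z ∈ Φ.X₁R R Γ) (hzb : z ∈ Φ.big Γ) (hzs : z ∈ Φ.small Γ) :
    z ∈ hexBall (Φ.centre + ![4 * (Γ.m : ℤ) - Φ.period * Γ.s, Φ.period * Γ.s + 2 * Γ.m]) R := by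
  simp only [X₁R, Set.mem_setOf_eq] at hz
  rw [mem_big_iff] at hzb
  rw [mem_small_iff] at hzs
  rw [mem_hexBall_iff_lin]
  simp only [Pi.add_apply, Matrix.cons_val_zero, Matrix.cons_val_one]
  omega

/-- `X₂R` (within `big`) lies in the hexagon of radius `R + 1` about the corner `c + (6m, 0)` of `big`. [folklore] -/
theorem X₂R_subset {R : ℕ} {Γ : GlueData} {z : Site 2} (hz : z ∈ Φ.X₂R R Γ) (hzb : z ∈ Φ.big Γ) :
    z ∈ hexBall (Φ.centre + ![6 * (Γ.m : ℤ), 0]) (R + 1) := by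
  simp only [X₂R, Set.mem_setOf_eq] at hz
  rw [mem_big_iff] at hzb
  rw [mem_hexBall_iff_lin]
  simp only [Pi.add_apply, Matrix.cons_val_zero, Matrix.cons_val_one]
  push_cast
  omega

/-- `zBadR` lies in the two hexagons of radius `4R` about the ends `c + (6m, P·s − m ∓ a)` of `Z_n`. [folklore] -/
theorem zBadR_subset {R : ℕ} {Γ : GlueData} {z : Site 2} (hz : z ∈ Φ.zBadR R Γ) :
    z ∈ hexBall (Φ.centre + ![6 * (Γ.m : ℤ), Φ.period * Γ.s - Γ.m - Γ.a]) (4 * R) ∨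
      z ∈ hexBall (Φ.centre + ![6 * (Γ.m : ℤ), Φ.period * Γ.s - Γ.m + Γ.a]) (4 * R) := by
  obtain ⟨⟨w, hw, hwZ⟩, w', hw', hw'0, hw'Z⟩ := hz
  rw [mem_zSeg_iff] at hwZ hw'Z
  rw [mem_hexBall_iff_lin] at hw hw'
  simp only [not_and_or, not_le] at hw'Z
  rw [mem_hexBall_iff_lin, mem_hexBall_iff_lin]
  simp only [Pi.add_apply, Matrix.cons_val_zero, Matrix.cons_val_one]
  push_cast
  rcases hw'Z with h | h | h
  · exact absurd hw'0 h
  · left; omega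
  · right; omega

end HexShadow

end Summit.CriticalPhenomena.PercolationContinuityZ3.Theorems.Transplant

end
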